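/-
Copyright (c) 2026 the pub-hodgecm-mathlib formalisation cell (harness21).  Prover seat hodgecm-mathlib-LH5-p03 (g2): brick (W-a) «ONE-UNITS-SQUARES» of the WILD
‹U-FIN› road of half A line LH4 (dealer LH4-plan (g3) WORDS #12∕#13; consumer LH10-p01 (g3), files (W-b) `QuadraticNormIndexFiniteCM` ∕ (W-c)); 2026-09-02.
-/
import Mathlib.RingTheory.Henselian
import Mathlib.Topology.Algebra.Valued.ValuedField
import Literature.NumberTheory.Automorphic.AdicCompletionIntegersAdicComplete   -- ★ `isAdicComplete_valuedMaximalIdeal_valuedInteger_adicCompletion` (the instance datum at `K_v`, `Valued` spelling)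
import HarnessLib

/-!
# Square roots near `1` in a valued field with `𝔪`-adically complete valuation ring: `v(s − 1) < v(4) ⇒ s = r²` with `v(r − 1) < v(2)`

Topic `NumberTheory/LocalFields`; namespace `Literature.NumberTheory.LocalFields`.  THEOREMS ONLY (no definition, no instance, no notation, no named fact, no
`sorry`); CM-free; kernel lane `--supports stmt-HodgeConjecture-24833`.  Cell `pub/hodgecm-mathlib` (D-0151), crux H413 = `stmt-HodgeConjecture-24833`; half A line
LH4 (closer stub `stub_N6ns`), DYADIC pay-down leaf `Cruxes/H413/Lines/F0_P3c_DyadicPaydown.lean` ED. 1 (a78d34cdd4c5), organ (D-SH) `stub_DyShalika`, WILD ‹U-FIN› road: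
(W-a) THIS FILE → (W-b) `LocalFields/QuadraticNormIndexFiniteCM` («`F^× ∕ N E^×` finite at every place», LH10-p01 (g3)) → (W-c) `Rogawski1990/UnitaryThreeUnipotentClassesFiniteAllCM`
(★ p849177's ‹U-FIN› with the parity hypothesis deleted).  HONEST LABEL: HC_CM is proved only modulo the 7 printed citations (2 remaining named inputs: hLiu418 =
stmt-HodgeConjecture-24832, h413 = stmt-HodgeConjecture-24833) until rung 0 closes; this file is count-neutral and Mathlib-footed.

WHAT.  The «strong Hensel» square-root statement for `X² − s` at the approximate root `1`, where `|f(1)| = |s − 1| < |4| = |f′(1)|²`, in EVERY residue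
characteristic (at a dyadic place this is the classical «a one-unit `≡ 1 (mod 4𝔪)` is a square»; away from `2` it is plain Hensel; if `4 = 0` in `K` the hypothesis is void):
for a field `K` with a valuation `v = Valued.v : K → ℤᵐ⁰` whose valuation ring `𝒪[K]` is complete for the `𝓂[K]`-adic topology,
`v(s − 1) < v(4) ⇒ ∃ r, r·r = s ∧ v(r − 1) < v(2)`.
The RADIUS clause `v(r − 1) < v 2` singles out ONE of the two roots `±r` (`v(−r − 1) = v 2`), which is what makes the root Galois-fixed when `s` is (used in (W-b)).
PROOF (division-free after one inversion; no Newton iteration).  `4 ≠ 0` (else `v(s − 1) < 0`); put `y := (s − 1)·4⁻¹`, so `v y < 1`, i.e. `y ∈ 𝓂[K]`.  The MONIC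
polynomial `f = X² + X − y ∈ 𝒪[K][X]` has `f(0) = −y ∈ 𝓂[K]` and `f′(0) = 1`, so Hensel's lemma for the `𝓂[K]`-adically complete ring `𝒪[K]` (Mathlib
`IsAdicComplete.henselianRing`, simple residual root) gives `x ∈ 𝓂[K]` with `x² + x = y`; then `r := 1 + 2x` has `r·r = 1 + 4(x + x²) = 1 + 4y = s` identically and
`v(r − 1) = v 2 · v x < v 2`.

* `exists_mul_self_eq_of_valued_sub_one_lt_four` — the generic head (contract of LH4-plan (g3) WORD #13 with the single binder swap `[CompleteSpace K]` ↦
  `[IsAdicComplete 𝓂[K] 𝒪[K]]` announced 07:24Z: Mathlib's Hensel step is keyed on `IsAdicComplete`, which Mathlib does not derive from a bare complete `ℤᵐ⁰`-valued field).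
* `isSquare_of_valued_sub_one_lt_four` — the `IsSquare` reading ((W-a-i) «existential radius `c = 4`» for the ‹SPAN-wild› road).
* `exists_mul_self_eq_of_valued_sub_one_lt_four_adicCompletion` — the instantiation at the completion `K_v` of a number field at ANY finite place `v` (the consumer's
  `hsq` binder at `K := L`, `v := w.1`, token for token), the instance datum being ★ `isAdicComplete_valuedMaximalIdeal_valuedInteger_adicCompletion`.
* `isSquare_of_valued_sub_one_lt_four_adicCompletion` — its `IsSquare` reading.

## References
* [Serre1979] J.-P. Serre, *Local Fields*, GTM 67 (1979), Ch. II §4 Prop. 7 (Hensel's lemma in complete discrete valuation rings); Ch. XIV §4 (squares among one-units).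
* [NeukirchANT1999] J. Neukirch, *Algebraic Number Theory* (1999), Ch. II (4.6) (Hensel's lemma), Ch. II §5 (one-units).
* The Stacks project, Tag 04GE (Henselian pairs; `I`-adically complete ⇒ Henselian) — Mathlib `RingTheory/Henselian.lean`.
-/

set_option autoImplicit false

noncomputable section

open scoped Valued WithZero
open Polynomial NumberField IsDedekindDomain

namespace Literature.NumberTheory.LocalFields

/-- **SQUARE ROOTS NEAR `1` (strong Hensel for `X² − s`), generic head.**  Let `K` be a field with a valuation `Valued.v : K → ℤᵐ⁰` whose valuation ring `𝒪[K]` is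
`𝓂[K]`-adically complete.  If `v(s − 1) < v(4)` then `s = r·r` for some `r ∈ K` with `v(r − 1) < v(2)` (the root congruent to `1`; the other one, `−r`, has `v(−r − 1) = v 2`).
Every residue characteristic; vacuous when `4 = 0` in `K`.  Proof: Hensel (Mathlib `IsAdicComplete.henselianRing`) for the monic `X² + X − y`, `y = (s − 1)∕4 ∈ 𝓂[K]`, at the
simple residual root `0`, then `r = 1 + 2x`.  [cite: Serre1979, Ch. II §4 Prop. 7; Ch. XIV §4] [cite: NeukirchANT1999, Ch. II (4.6)] -/
theorem exists_mul_self_eq_of_valued_sub_one_lt_four {K : Type*} [Field K] [Valued K ℤᵐ⁰] [IsAdicComplete 𝓂[K] 𝒪[K]]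
    (s : K) (hs : Valued.v (s - 1) < Valued.v (4 : K)) :
    ∃ r : K, r * r = s ∧ Valued.v (r - 1) < Valued.v (2 : K) := by
  -- ## 0. `4 ≠ 0`, `2 ≠ 0`
  have h4 : (4 : K) ≠ 0 := by
    intro h4
    rw [h4, map_zero] at hs
    exact not_lt_zero hs
  have h2 : (2 : K) ≠ 0 := by
    intro h2
    apply h4
    rw [show (4 : K) = 2 * 2 by norm_num, h2, mul_zero]
  have hv4 : Valued.v (4 : K) ≠ 0 := (Valuation.ne_zero_iff _).2 h4
  have hv2 : Valued.v (2 : K) ≠ 0 := (Valuation.ne_zero_iff _).2 h2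
  -- ## 1. `y := (s − 1)·4⁻¹ ∈ 𝓂[K]`
  set y : K := (s - 1) * (4 : K)⁻¹ with hy
  have hy4 : y * 4 = s - 1 := by rw [hy, inv_mul_cancel_right₀ h4]
  have hvy : Valued.v y < 1 := by
    have h := mul_lt_mul_of_pos_right hs (zero_lt_iff.2 (inv_ne_zero hv4))
    rwa [← map_inv₀, ← map_mul, ← hy, map_inv₀, mul_inv_cancel₀ hv4] at h
  have hyO : y ∈ 𝒪[K] := (Valuation.mem_integer_iff _ _).2 hvy.le
  set yO : 𝒪[K] := ⟨y, hyO⟩ with hyO_def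
  have hyM : yO ∈ 𝓂[K] := by
    rw [Valued.maximalIdeal, IsLocalRing.mem_maximalIdeal, mem_nonunits_iff, Valuation.Integer.not_isUnit_iff_valuation_lt_one]
    exact hvy
  -- ## 2. Hensel for the monic `f = X² + X − y` at `a₀ = 0`: `f(0) = −y ∈ 𝓂`, `f′(0) = 1`
  set f : (𝒪[K])[X] := X ^ 2 + (X - C yO) with hf
  have hmonic : f.Monic := by
    rw [hf]
    refine monic_X_pow_add ?_
    rw [degree_X_sub_C]
    exact WithBot.coe_lt_coe.2 (by norm_num)
  have heval : f.eval 0 = -yO := by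
    simp only [hf, eval_add, eval_pow, eval_X, eval_sub, eval_C, ne_eq, OfNat.ofNat_ne_zero, not_false_eq_true, zero_pow, zero_sub, zero_add]
  have hderiv : f.derivative.eval 0 = 1 := by
    simp only [hf, derivative_add, derivative_X_pow, derivative_sub, derivative_X, derivative_C, sub_zero, eval_add, eval_mul, eval_C, eval_pow, eval_X,
      eval_one, Nat.cast_ofNat]
    norm_num
  have h₁ : f.eval 0 ∈ 𝓂[K] := by
    rw [heval]
    exact neg_mem hyM
  have h₂ : IsUnit (Ideal.Quotient.mk 𝓂[K] (f.derivative.eval 0)) := by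
    rw [hderiv, map_one]
    exact isUnit_one
  obtain ⟨x, hxroot, hxM⟩ := HenselianRing.is_henselian (I := 𝓂[K]) f hmonic 0 h₁ h₂
  rw [sub_zero] at hxM
  -- ## 3. read the root in `K`: `x² + x = y`, `v x < 1`
  have hxK : (x : K) ^ 2 + ((x : K) - y) = 0 := by
    have h := hxroot
    rw [IsRoot.def, hf, eval_add, eval_pow, eval_X, eval_sub, eval_X, eval_C] at h
    have h' := congrArg (fun z : 𝒪[K] => (z : K)) h
    simpa [hyO_def] using h'
  have hvx : Valued.v (x : K) < 1 := by
    rw [Valued.maximalIdeal, IsLocalRing.mem_maximalIdeal, mem_nonunits_iff, Valuation.Integer.not_isUnit_iff_valuation_lt_one] at hxM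
    exact hxM
  -- ## 4. `r := 1 + 2x`
  refine ⟨1 + 2 * (x : K), ?_, ?_⟩
  · linear_combination (4 : K) * hxK + hy4
  · rw [add_sub_cancel_left, map_mul]
    have h := mul_lt_mul_of_pos_right hvx (zero_lt_iff.2 hv2)
    rwa [one_mul, mul_comm] at h

/-- **`IsSquare` reading** of ★ `exists_mul_self_eq_of_valued_sub_one_lt_four`: `v(s − 1) < v(4) ⇒ IsSquare s` ((W-a-i) «existential radius», `c = 4`).
[cite: Serre1979, Ch. XIV §4] -/
theorem isSquare_of_valued_sub_one_lt_four {K : Type*} [Field K] [Valued K ℤᵐ⁰] [IsAdicComplete 𝓂[K] 𝒪[K]]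
    (s : K) (hs : Valued.v (s - 1) < Valued.v (4 : K)) : IsSquare s := by
  obtain ⟨r, hr, -⟩ := exists_mul_self_eq_of_valued_sub_one_lt_four s hs
  exact ⟨r, hr.symm⟩

/-- **SQUARE ROOTS NEAR `1` IN `K_v`** — the completion of a number field `K` at ANY finite place `v` (every residue characteristic, dyadic included): `v(s − 1) < v(4) ⇒
s = r·r` with `v(r − 1) < v(2)`.  The instance datum `IsAdicComplete 𝓂[K_v] 𝒪[K_v]` is ★ `isAdicComplete_valuedMaximalIdeal_valuedInteger_adicCompletion` (Mathlib's local-field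
completeness transported to the `Valued` spelling); this is the `hsq` binder of (W-b) `QuadraticNormIndexFiniteCM` at `K := L`, `v := w.1`, token for token.
[cite: Serre1979, Ch. II §4 Prop. 7; Ch. XIV §4] -/
theorem exists_mul_self_eq_of_valued_sub_one_lt_four_adicCompletion (K : Type*) [Field K] [NumberField K] (v : HeightOneSpectrum (𝓞 K))
    (s : v.adicCompletion K) (hs : Valued.v (s - 1) < Valued.v (4 : v.adicCompletion K)) :
    ∃ r : v.adicCompletion K, r * r = s ∧ Valued.v (r - 1) < Valued.v (2 : v.adicCompletion K) :=
  haveI := Literature.NumberTheory.Automorphic.isAdicComplete_valuedMaximalIdeal_valuedInteger_adicCompletion K v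
  exists_mul_self_eq_of_valued_sub_one_lt_four s hs

/-- **`IsSquare` reading at `K_v`**: `v(s − 1) < v(4) ⇒ IsSquare s` in the completion of a number field at any finite place. [cite: Serre1979, Ch. XIV §4] -/
theorem isSquare_of_valued_sub_one_lt_four_adicCompletion (K : Type*) [Field K] [NumberField K] (v : HeightOneSpectrum (𝓞 K))
    (s : v.adicCompletion K) (hs : Valued.v (s - 1) < Valued.v (4 : v.adicCompletion K)) : IsSquare s := by
  obtain ⟨r, hr, -⟩ := exists_mul_self_eq_of_valued_sub_one_lt_four_adicCompletion K v s hs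
  exact ⟨r, hr.symm⟩

end Literature.NumberTheory.LocalFields

end
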